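import Summits.Ventures.PercRepro.Night2GeneralQPoly

/-!
# PercRepro — the polynomial target-sum inequality `PolyIneq q n` of the regime `(q − 1, q − 3)` for `15 ≤ n ≤ 19`
(night-2, gen 21)

For each `n` the inequality `2 ((q³ + 2q² + 9q + 12) − (2q + 3) n) C(n, 4) ≤ 2 (2q + 3)(n + q − 4) A(n) + q (q + 1)² (n + q − 4)(n + 1)`
is proved for every `q ≥ 4` in three ranges: for small `q` the `A`-term alone carries the left side (a concave
cubic in `q`, certified by `(q − 4)(Q_A − q)(2 C q + β) ≥ 0` and its chord), for large `q` the `T`-term alone does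
(the Horner chain `q⁴ ≥ Q_T q³ ≥ Q_T² q² ≥ …`), and the finitely many `q` in between are evaluated in the kernel
(`A(n)` and `C(n, 4)` as numerals, `decide`).  Constants and ranges from `mining/night-2/g21/regions21b.py`.
-/

namespace PercRepro.Shadow

open Finset PerFlat ThmH

/-- `PolyIneq q 15` for every `q ≥ 4` (`A(15) = 30811`, `C(15, 4) = 1365`; `A`-term alone for `q ≤ 54`, `T`-term alone for `q ≥ 160`, kernel evaluation between). -/
theorem polyIneq_fifteen {q : ℕ} (hq : 4 ≤ q) : PolyIneq q 15 := by
  have hA : DGen.Aρt 15 4 2 = 30811 := by decide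
  have hC : Nat.choose 15 4 = 1365 := by decide
  unfold PolyIneq
  rw [hA, hC]
  push_cast
  have hx4 : (4 : ℚ) ≤ (q : ℚ) := by exact_mod_cast hq
  have hnq : (0 : ℚ) ≤ 15 + (q : ℚ) - 4 := by linarith
  have hT : (0 : ℚ) ≤ (q : ℚ) * ((q : ℚ) + 1) ^ 2 * (15 + (q : ℚ) - 4) * (15 + 1) :=
    mul_nonneg (mul_nonneg (by positivity) hnq) (by norm_num)
  have hAt : (0 : ℚ) ≤ 2 * (2 * (q : ℚ) + 3) * (15 + (q : ℚ) - 4) * 30811 :=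
    mul_nonneg (mul_nonneg (by linarith) hnq) (by norm_num)
  rcases le_or_gt q 54 with hle | hlt
  · have hQ : (q : ℚ) ≤ 54 := by exact_mod_cast hle
    have hlin : (0 : ℚ) ≤ 2 * 1365 * (q : ℚ) + 40556 := by linarith
    nlinarith [mul_nonneg (mul_nonneg (sub_nonneg.2 hx4) (sub_nonneg.2 hQ)) hlin, hT, hx4, hQ]
  · rcases le_or_gt 160 q with hge | hmid
    · have hQ : (160 : ℚ) ≤ (q : ℚ) := by exact_mod_cast hge
      have h1 : (160 : ℚ) * (q : ℚ) ≤ (q : ℚ) ^ 2 := by nlinarith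
      have h2 : (160 : ℚ) * (q : ℚ) ^ 2 ≤ (q : ℚ) ^ 3 := by nlinarith
      have h3 : (160 : ℚ) * (q : ℚ) ^ 3 ≤ (q : ℚ) ^ 4 := by nlinarith
      nlinarith [h1, h2, h3, hAt, hQ]
    · interval_cases q <;> norm_num

/-- `PolyIneq q 16` for every `q ≥ 4` (`A(16) = 63002`, `C(16, 4) = 1820`; `A`-term alone for `q ≤ 79`, `T`-term alone for `q ≥ 203`, kernel evaluation between). -/
theorem polyIneq_sixteen {q : ℕ} (hq : 4 ≤ q) : PolyIneq q 16 := by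
  have hA : DGen.Aρt 16 4 2 = 63002 := by decide
  have hC : Nat.choose 16 4 = 1820 := by decide
  unfold PolyIneq
  rw [hA, hC]
  push_cast
  have hx4 : (4 : ℚ) ≤ (q : ℚ) := by exact_mod_cast hq
  have hnq : (0 : ℚ) ≤ 16 + (q : ℚ) - 4 := by linarith
  have hT : (0 : ℚ) ≤ (q : ℚ) * ((q : ℚ) + 1) ^ 2 * (16 + (q : ℚ) - 4) * (16 + 1) :=
    mul_nonneg (mul_nonneg (by positivity) hnq) (by norm_num)
  have hAt : (0 : ℚ) ≤ 2 * (2 * (q : ℚ) + 3) * (16 + (q : ℚ) - 4) * 63002 :=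
    mul_nonneg (mul_nonneg (by linarith) hnq) (by norm_num)
  rcases le_or_gt q 79 with hle | hlt
  · have hQ : (q : ℚ) ≤ 79 := by exact_mod_cast hle
    have hlin : (0 : ℚ) ≤ 2 * 1820 * (q : ℚ) + 57392 := by linarith
    nlinarith [mul_nonneg (mul_nonneg (sub_nonneg.2 hx4) (sub_nonneg.2 hQ)) hlin, hT, hx4, hQ]
  · rcases le_or_gt 203 q with hge | hmid
    · have hQ : (203 : ℚ) ≤ (q : ℚ) := by exact_mod_cast hge
      have h1 : (203 : ℚ) * (q : ℚ) ≤ (q : ℚ) ^ 2 := by nlinarith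
      have h2 : (203 : ℚ) * (q : ℚ) ^ 2 ≤ (q : ℚ) ^ 3 := by nlinarith
      have h3 : (203 : ℚ) * (q : ℚ) ^ 3 ≤ (q : ℚ) ^ 4 := by nlinarith
      nlinarith [h1, h2, h3, hAt, hQ]
    · interval_cases q <;> norm_num

/-- `PolyIneq q 17` for every `q ≥ 4` (`A(17) = 127840`, `C(17, 4) = 2380`; `A`-term alone for `q ≤ 118`, `T`-term alone for `q ≥ 252`, kernel evaluation between). -/
theorem polyIneq_seventeen {q : ℕ} (hq : 4 ≤ q) : PolyIneq q 17 := by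
  have hA : DGen.Aρt 17 4 2 = 127840 := by decide
  have hC : Nat.choose 17 4 = 2380 := by decide
  unfold PolyIneq
  rw [hA, hC]
  push_cast
  have hx4 : (4 : ℚ) ≤ (q : ℚ) := by exact_mod_cast hq
  have hnq : (0 : ℚ) ≤ 17 + (q : ℚ) - 4 := by linarith
  have hT : (0 : ℚ) ≤ (q : ℚ) * ((q : ℚ) + 1) ^ 2 * (17 + (q : ℚ) - 4) * (17 + 1) :=
    mul_nonneg (mul_nonneg (by positivity) hnq) (by norm_num)
  have hAt : (0 : ℚ) ≤ 2 * (2 * (q : ℚ) + 3) * (17 + (q : ℚ) - 4) * 127840 :=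
    mul_nonneg (mul_nonneg (by linarith) hnq) (by norm_num)
  rcases le_or_gt q 118 with hle | hlt
  · have hQ : (q : ℚ) ≤ 118 := by exact_mod_cast hle
    have hlin : (0 : ℚ) ≤ 2 * 2380 * (q : ℚ) + 78880 := by linarith
    nlinarith [mul_nonneg (mul_nonneg (sub_nonneg.2 hx4) (sub_nonneg.2 hQ)) hlin, hT, hx4, hQ]
  · rcases le_or_gt 252 q with hge | hmid
    · have hQ : (252 : ℚ) ≤ (q : ℚ) := by exact_mod_cast hge
      have h1 : (252 : ℚ) * (q : ℚ) ≤ (q : ℚ) ^ 2 := by nlinarith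
      have h2 : (252 : ℚ) * (q : ℚ) ^ 2 ≤ (q : ℚ) ^ 3 := by nlinarith
      have h3 : (252 : ℚ) * (q : ℚ) ^ 3 ≤ (q : ℚ) ^ 4 := by nlinarith
      nlinarith [h1, h2, h3, hAt, hQ]
    · interval_cases q <;> norm_num

/-- `PolyIneq q 18` for every `q ≥ 4` (`A(18) = 258077`, `C(18, 4) = 3060`; `A`-term alone for `q ≤ 181`, `T`-term alone for `q ≥ 309`, kernel evaluation between). -/
theorem polyIneq_eighteen {q : ℕ} (hq : 4 ≤ q) : PolyIneq q 18 := by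
  have hA : DGen.Aρt 18 4 2 = 258077 := by decide
  have hC : Nat.choose 18 4 = 3060 := by decide
  unfold PolyIneq
  rw [hA, hC]
  push_cast
  have hx4 : (4 : ℚ) ≤ (q : ℚ) := by exact_mod_cast hq
  have hnq : (0 : ℚ) ≤ 18 + (q : ℚ) - 4 := by linarith
  have hT : (0 : ℚ) ≤ (q : ℚ) * ((q : ℚ) + 1) ^ 2 * (18 + (q : ℚ) - 4) * (18 + 1) :=
    mul_nonneg (mul_nonneg (by positivity) hnq) (by norm_num)
  have hAt : (0 : ℚ) ≤ 2 * (2 * (q : ℚ) + 3) * (18 + (q : ℚ) - 4) * 258077 :=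
    mul_nonneg (mul_nonneg (by linarith) hnq) (by norm_num)
  rcases le_or_gt q 181 with hle | hlt
  · have hQ : (q : ℚ) ≤ 181 := by exact_mod_cast hle
    have hlin : (0 : ℚ) ≤ 2 * 3060 * (q : ℚ) + 112132 := by linarith
    nlinarith [mul_nonneg (mul_nonneg (sub_nonneg.2 hx4) (sub_nonneg.2 hQ)) hlin, hT, hx4, hQ]
  · rcases le_or_gt 309 q with hge | hmid
    · have hQ : (309 : ℚ) ≤ (q : ℚ) := by exact_mod_cast hge
      have h1 : (309 : ℚ) * (q : ℚ) ≤ (q : ℚ) ^ 2 := by nlinarith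
      have h2 : (309 : ℚ) * (q : ℚ) ^ 2 ≤ (q : ℚ) ^ 3 := by nlinarith
      have h3 : (309 : ℚ) * (q : ℚ) ^ 3 ≤ (q : ℚ) ^ 4 := by nlinarith
      nlinarith [h1, h2, h3, hAt, hQ]
    · interval_cases q <;> norm_num

/-- `PolyIneq q 19` for every `q ≥ 4` (`A(19) = 519232`, `C(19, 4) = 3876`; `A`-term alone for `q ≤ 281`, `T`-term alone for `q ≥ 373`, kernel evaluation between). -/
theorem polyIneq_nineteen {q : ℕ} (hq : 4 ≤ q) : PolyIneq q 19 := by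
  have hA : DGen.Aρt 19 4 2 = 519232 := by decide
  have hC : Nat.choose 19 4 = 3876 := by decide
  unfold PolyIneq
  rw [hA, hC]
  push_cast
  have hx4 : (4 : ℚ) ≤ (q : ℚ) := by exact_mod_cast hq
  have hnq : (0 : ℚ) ≤ 19 + (q : ℚ) - 4 := by linarith
  have hT : (0 : ℚ) ≤ (q : ℚ) * ((q : ℚ) + 1) ^ 2 * (19 + (q : ℚ) - 4) * (19 + 1) :=
    mul_nonneg (mul_nonneg (by positivity) hnq) (by norm_num)
  have hAt : (0 : ℚ) ≤ 2 * (2 * (q : ℚ) + 3) * (19 + (q : ℚ) - 4) * 519232 :=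
    mul_nonneg (mul_nonneg (by linarith) hnq) (by norm_num)
  rcases le_or_gt q 281 with hle | hlt
  · have hQ : (q : ℚ) ≤ 281 := by exact_mod_cast hle
    have hlin : (0 : ℚ) ≤ 2 * 3876 * (q : ℚ) + 147896 := by linarith
    nlinarith [mul_nonneg (mul_nonneg (sub_nonneg.2 hx4) (sub_nonneg.2 hQ)) hlin, hT, hx4, hQ]
  · rcases le_or_gt 373 q with hge | hmid
    · have hQ : (373 : ℚ) ≤ (q : ℚ) := by exact_mod_cast hge
      have h1 : (373 : ℚ) * (q : ℚ) ≤ (q : ℚ) ^ 2 := by nlinarith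
      have h2 : (373 : ℚ) * (q : ℚ) ^ 2 ≤ (q : ℚ) ^ 3 := by nlinarith
      have h3 : (373 : ℚ) * (q : ℚ) ^ 3 ≤ (q : ℚ) ^ 4 := by nlinarith
      nlinarith [h1, h2, h3, hAt, hQ]
    · interval_cases q <;> norm_num

end PercRepro.Shadow

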